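import Mathlib
import Literature.Analysis.ODE.ParametricLinear
import Summits.AtomisticToContinuum.HydrodynamicLimit.Theorems.ImplosionDichotomyDenseExcursionR2Modes

/-!
# Regular linear `2 × 2` systems (global affine solutions, uniqueness, smoothness) and the germ nature of `IsRegularPair`
# (crux `DenseExcursion`, line `sonic-cavity-renewal`, bricks for stub `stub_cavityResolventCk`)

Helper file (`--supports stmt-AtomisticToContinuum-12586`, line lead a2, stub-worker E for `stub_cavityResolventCk`,
theorems T3–T5 of its decomposition). Infrastructure shared by the exterior continuation (T5), the transport on
non-characteristic segments (T4) and the centre branch (T3) of the resolvent equation `Λŵ − linW = f`, `Λŝ − linS = g`: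

* `exists_solution_affine` — GLOBAL SOLUTIONS OF AN AFFINE LINEAR EQUATION `v′ = L(t)v + b(t)` on a Banach space, `L`
  continuous with values in `E →L[ℝ] E`, `b` continuous, through any `(t₀, x₀)` (homogenisation `(v, c) ↦ (Lv + c·b, 0)` on
  `E × ℝ`, then `Literature.Analysis.ODE.exists_solution_of_linearGrowth_at`);
* `eqOn_of_hasDerivAt_affine` — uniqueness on an open interval (the difference solves the linear equation:
  `Literature.Analysis.ODE.eqOn_of_hasDerivAt_linear`);
* `contDiffOn_of_hasDerivAt_affine` — a solution is `C^∞` on every open set where `L` and `b` are (bootstrap);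
* `exists_clmField_two`, `exists_affine_solution_two`, `eqOn_of_affine_solution_two` — the same three facts for the complex `2 × 2` system
  `p′ = a₁₁p + a₁₂q + b₁`, `q′ = a₂₁p + a₂₂q + b₂` with continuous coefficient functions `ℝ → ℂ`, written through a field of
  REAL continuous linear maps on `ℂ²` (`z ↦ Σ aᵢⱼ(t) • Pᵢⱼ z`);
* `isRegularPair_of_eqOn` (registered helper) — `IsRegularPair` IS A CONDITION ON THE GERM AT THE CENTRE (plus global
  smoothness): if `(ŵ₀, ŝ₀)` is a regular pair and the `C^∞` pair `(ŵ, ŝ)` agrees with it on some `(−∞, b)`, then `(ŵ, ŝ)`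
  is a regular pair. The smooth fields on `ℝ³` are re-built as `y ↦ Re ŵ(log ‖y‖)·y` (etc.) off the origin and the old value
  at the origin: on the ball `‖y‖ < e^b` this IS the old smooth field, and off the origin it is smooth because `log ‖·‖` is
  (`exists_field_of_eqOn`, `exists_scalar_of_eqOn`). This is the gluing step of every continuation argument for centre-regular
  solutions (the exterior continuation modifies a regular pair only on `x > 1/8`).

Sources: Hartman, *Ordinary Differential Equations* (SIAM 2002) Ch. IV Lemma 1.1; Lang, *Differential and Riemannian
Manifolds* (1995) Ch. IV §1 Prop. 1.9. All folklore; everything proved.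
-/

noncomputable section

open Set Filter
open scoped Topology ContDiff NNReal

namespace Summit.AtomisticToContinuum.HydrodynamicLimit.Theorems.SonicCavityRenewal

open Summit.AtomisticToContinuum.HydrodynamicLimit.Theorems.R2OneModeTwoConditions
open Literature.MathematicalPhysics.KineticTheory (V3)

/-! ## Affine linear equations on a Banach space -/

section Affine

variable {E : Type*} [NormedAddCommGroup E] [NormedSpace ℝ E]

/-- **GLOBAL SOLUTIONS OF AN AFFINE LINEAR EQUATION.** For `L : ℝ → (E →L[ℝ] E)` and `b : ℝ → E` continuous (Banach `E`)
and any `(t₀, x₀)` there is `v : ℝ → E` with `v t₀ = x₀` and `v′(t) = L(t)v(t) + b(t)` for all `t`. Homogenise on `E × ℝ`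
(`(x, c) ↦ (L x + c·b, 0)`, a field of linear growth with constant `sup_{[−T,T]}(‖L‖ + ‖b‖)`), solve globally
(`Literature.Analysis.ODE.exists_solution_of_linearGrowth_at`, Hartman Ch. IV Lemma 1.1) from `(x₀, 1)`; the second
component stays `1`. [folklore] -/
theorem exists_solution_affine [CompleteSpace E] {L : ℝ → E →L[ℝ] E} {b : ℝ → E} (hL : Continuous L)
    (hb : Continuous b) (t₀ : ℝ) (x₀ : E) :
    ∃ v : ℝ → E, v t₀ = x₀ ∧ ∀ t, HasDerivAt v (L t (v t) + b t) t := by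
  set w : ℝ → E × ℝ → E × ℝ := fun t p => (L t p.1 + p.2 • b t, 0) with hw
  have hlin : ∀ t p p', w t p - w t p' = w t (p - p') := by
    intro t p p'
    refine Prod.ext ?_ ?_
    · simp only [hw, Prod.fst_sub, Prod.snd_sub, map_sub, sub_smul]
      abel
    · simp [hw]
  have hgrowth : ∀ t p, ‖w t p‖ ≤ (‖L t‖ + ‖b t‖) * ‖p‖ := by
    intro t p
    have h1 : ‖p.1‖ ≤ ‖p‖ := norm_fst_le p
    have h2 : ‖p.2‖ ≤ ‖p‖ := norm_snd_le p
    calc ‖w t p‖ = ‖L t p.1 + p.2 • b t‖ := by simp [hw, Prod.norm_def]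
      _ ≤ ‖L t p.1‖ + ‖p.2 • b t‖ := norm_add_le _ _
      _ ≤ ‖L t‖ * ‖p.1‖ + ‖p.2‖ * ‖b t‖ := add_le_add ((L t).le_opNorm _) (by rw [norm_smul])
      _ ≤ ‖L t‖ * ‖p‖ + ‖p‖ * ‖b t‖ := by gcongr
      _ = (‖L t‖ + ‖b t‖) * ‖p‖ := by ring
  have hK : ∀ T : ℝ, ∃ K : ℝ≥0, ∀ t ∈ Icc (-T) T, LipschitzWith K (w t) ∧ ∀ p, ‖w t p‖ ≤ K * ‖p‖ := by
    intro T
    have hc : Continuous fun t => ‖L t‖ + ‖b t‖ := hL.norm.add hb.norm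
    obtain ⟨K₀, hK₀⟩ := (isCompact_Icc (a := -T) (b := T)).exists_bound_of_continuousOn hc.continuousOn
    refine ⟨⟨max K₀ 0, le_max_right _ _⟩, fun t ht => ?_⟩
    have hKt : ‖L t‖ + ‖b t‖ ≤ max K₀ 0 := by
      have h := hK₀ t ht
      rw [Real.norm_of_nonneg (by positivity)] at h
      exact h.trans (le_max_left _ _)
    have hg : ∀ p, ‖w t p‖ ≤ max K₀ 0 * ‖p‖ := fun p =>
      (hgrowth t p).trans (mul_le_mul_of_nonneg_right hKt (norm_nonneg _))
    refine ⟨LipschitzWith.of_dist_le_mul fun p p' => ?_, hg⟩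
    rw [dist_eq_norm, dist_eq_norm, hlin]
    exact hg (p - p')
  have hcont : ∀ p, Continuous (w · p) := fun p =>
    ((hL.clm_apply continuous_const).add (continuous_const.smul hb)).prodMk continuous_const
  obtain ⟨α, hα0, hα⟩ := Literature.Analysis.ODE.exists_solution_of_linearGrowth_at hK hcont t₀ (x₀, 1)
  -- the second component is constant `= 1`
  have h2 : ∀ t, (α t).2 = 1 := by
    have hd : ∀ t, HasDerivAt (fun s => (α s).2) 0 t := fun t => by
      have h := (ContinuousLinearMap.snd ℝ E ℝ).hasFDerivAt.comp_hasDerivAt t (hα t)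
      simpa [hw, Function.comp_def] using h
    intro t
    rw [is_const_of_deriv_eq_zero (fun s => (hd s).differentiableAt) (fun s => (hd s).deriv) t t₀, hα0]
  refine ⟨fun t => (α t).1, by simp [hα0], fun t => ?_⟩
  have h := (ContinuousLinearMap.fst ℝ E ℝ).hasFDerivAt.comp_hasDerivAt t (hα t)
  simpa [hw, Function.comp_def, h2 t] using h

/-- **UNIQUENESS FOR AN AFFINE LINEAR EQUATION** on an open interval: two solutions of `v′ = L(t)v + b(t)`, `L` continuous
on `(a, c)`, agreeing at one `t₀ ∈ (a, c)` agree on `(a, c)` (their difference solves the linear equation;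
`Literature.Analysis.ODE.eqOn_of_hasDerivAt_linear`, Lang Ch. IV §1 Prop. 1.9). [folklore] -/
theorem eqOn_of_hasDerivAt_affine {L : ℝ → E →L[ℝ] E} {b : ℝ → E} {a c t₀ : ℝ} (ht₀ : t₀ ∈ Ioo a c)
    (hL : ContinuousOn L (Ioo a c)) {v₁ v₂ : ℝ → E}
    (h₁ : ∀ t ∈ Ioo a c, HasDerivAt v₁ (L t (v₁ t) + b t) t)
    (h₂ : ∀ t ∈ Ioo a c, HasDerivAt v₂ (L t (v₂ t) + b t) t) (heq : v₁ t₀ = v₂ t₀) :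
    EqOn v₁ v₂ (Ioo a c) := by
  have hd : ∀ t ∈ Ioo a c, HasDerivAt (fun s => v₁ s - v₂ s) (L t (v₁ t - v₂ t)) t := by
    intro t ht
    have h := (h₁ t ht).sub (h₂ t ht)
    have he : L t (v₁ t) + b t - (L t (v₂ t) + b t) = L t (v₁ t - v₂ t) := by rw [map_sub]; abel
    rw [he] at h
    exact h
  have h0 : ∀ t ∈ Ioo a c, HasDerivAt (fun _ : ℝ => (0 : E)) (L t ((fun _ : ℝ => (0 : E)) t)) t := by
    intro t _
    simpa using hasDerivAt_const t (0 : E)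
  have key := Literature.Analysis.ODE.eqOn_of_hasDerivAt_linear ht₀ hL hd h0 (by simp [heq])
  intro t ht
  have h := key ht
  exact sub_eq_zero.1 (by simpa using h)

-- adapted from Literature/Geometry/Riemannian/ShrinkerPotentialGrowthProofs.lean (`contDiffOn_of_hasDerivAt_linear`)
/-- **SOLUTIONS OF AN AFFINE LINEAR EQUATION WITH `C^∞` DATA ARE `C^∞`**: if `v′ = L(t)v + b(t)` on an open set of
times where `L` and `b` are `C^∞`, then `v` is `C^∞` there (bootstrap `v ∈ C^k ⇒ v′ = Lv + b ∈ C^k ⇒ v ∈ C^{k+1}`;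
Lang Ch. IV §1, regularity part of Prop. 1.9). [folklore] -/
theorem contDiffOn_of_hasDerivAt_affine {L : ℝ → E →L[ℝ] E} {b : ℝ → E} {s : Set ℝ} (hs : IsOpen s)
    (hL : ContDiffOn ℝ ∞ L s) (hb : ContDiffOn ℝ ∞ b s) {v : ℝ → E}
    (hv : ∀ t ∈ s, HasDerivAt v (L t (v t) + b t) t) : ContDiffOn ℝ ∞ v s := by
  have hderiv : ∀ t ∈ s, deriv v t = L t (v t) + b t := fun t ht => (hv t ht).deriv
  have hdiff : DifferentiableOn ℝ v s := fun t ht => (hv t ht).differentiableAt.differentiableWithinAt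
  suffices h : ∀ k : ℕ, ContDiffOn ℝ k v s from contDiffOn_infty.2 h
  intro k
  induction k with
  | zero =>
    rw [Nat.cast_zero]
    exact contDiffOn_zero.2 hdiff.continuousOn
  | succ k ih =>
    rw [Nat.cast_succ, contDiffOn_succ_iff_deriv_of_isOpen hs]
    refine ⟨hdiff, fun h => (WithTop.natCast_ne_top k h).elim, ?_⟩
    have hle : ((k : ℕ) : ℕ∞ω) ≤ (∞ : ℕ∞ω) := by exact_mod_cast le_top
    exact (((hL.of_le hle).clm_apply ih).add (hb.of_le hle)).congr fun t ht => hderiv t ht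

end Affine

/-! ## The complex `2 × 2` system as a field of real continuous linear maps on `ℂ²` -/

/-- THE `2 × 2` FIELD: for continuous `aᵢⱼ : ℝ → ℂ` there is a continuous `L : ℝ → (ℂ² →L[ℝ] ℂ²)` with
`L(t)(z₁, z₂) = (a₁₁z₁ + a₁₂z₂, a₂₁z₁ + a₂₂z₂)`, of class `C^∞` on every set where the `aᵢⱼ` are
(`L(t) = Σ aᵢⱼ(t) • Pᵢⱼ` with the four coordinate maps `Pᵢⱼ`). [folklore] -/
theorem exists_clmField_two (a₁₁ a₁₂ a₂₁ a₂₂ : ℝ → ℂ) (h₁₁ : Continuous a₁₁) (h₁₂ : Continuous a₁₂)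
    (h₂₁ : Continuous a₂₁) (h₂₂ : Continuous a₂₂) :
    ∃ L : ℝ → (ℂ × ℂ) →L[ℝ] (ℂ × ℂ), Continuous L ∧
      (∀ t z, L t z = (a₁₁ t * z.1 + a₁₂ t * z.2, a₂₁ t * z.1 + a₂₂ t * z.2)) ∧
      ∀ s : Set ℝ, ContDiffOn ℝ ∞ a₁₁ s → ContDiffOn ℝ ∞ a₁₂ s → ContDiffOn ℝ ∞ a₂₁ s → ContDiffOn ℝ ∞ a₂₂ s →
        ContDiffOn ℝ ∞ L s := by
  set P₁₁ : (ℂ × ℂ) →L[ℝ] (ℂ × ℂ) := (ContinuousLinearMap.inl ℝ ℂ ℂ).comp (ContinuousLinearMap.fst ℝ ℂ ℂ)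
    with hP₁₁
  set P₁₂ : (ℂ × ℂ) →L[ℝ] (ℂ × ℂ) := (ContinuousLinearMap.inl ℝ ℂ ℂ).comp (ContinuousLinearMap.snd ℝ ℂ ℂ)
    with hP₁₂
  set P₂₁ : (ℂ × ℂ) →L[ℝ] (ℂ × ℂ) := (ContinuousLinearMap.inr ℝ ℂ ℂ).comp (ContinuousLinearMap.fst ℝ ℂ ℂ)
    with hP₂₁
  set P₂₂ : (ℂ × ℂ) →L[ℝ] (ℂ × ℂ) := (ContinuousLinearMap.inr ℝ ℂ ℂ).comp (ContinuousLinearMap.snd ℝ ℂ ℂ)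
    with hP₂₂
  refine ⟨fun t => a₁₁ t • P₁₁ + a₁₂ t • P₁₂ + a₂₁ t • P₂₁ + a₂₂ t • P₂₂, ?_, ?_, ?_⟩
  · exact (((h₁₁.smul continuous_const).add (h₁₂.smul continuous_const)).add
      (h₂₁.smul continuous_const)).add (h₂₂.smul continuous_const)
  · intro t z
    ext <;> simp [hP₁₁, hP₁₂, hP₂₁, hP₂₂]
  · intro s g₁₁ g₁₂ g₂₁ g₂₂
    exact (((g₁₁.smul contDiffOn_const).add (g₁₂.smul contDiffOn_const)).add
      (g₂₁.smul contDiffOn_const)).add (g₂₂.smul contDiffOn_const)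

/-- **GLOBAL `C¹` SOLUTIONS OF THE COMPLEX `2 × 2` AFFINE SYSTEM, SMOOTH WHERE THE DATA ARE.** For continuous
`aᵢⱼ, bᵢ : ℝ → ℂ` and any `(t₀, p₀, q₀)` there are `p q : ℝ → ℂ` with `p t₀ = p₀`, `q t₀ = q₀`,
`p′ = a₁₁p + a₁₂q + b₁`, `q′ = a₂₁p + a₂₂q + b₂` everywhere, and `p`, `q` are `C^∞` on every open set on which all six data
are `C^∞`. [folklore] -/
theorem exists_affine_solution_two : ∀ (a₁₁ a₁₂ a₂₁ a₂₂ b₁ b₂ : ℝ → ℂ), Continuous a₁₁ → Continuous a₁₂ → Continuous a₂₁ → Continuous a₂₂ → Continuous b₁ → Continuous b₂ → ∀ (t₀ : ℝ) (p₀ q₀ : ℂ), ∃ p q : ℝ → ℂ, p t₀ = p₀ ∧ q t₀ = q₀ ∧ (∀ t, HasDerivAt p (a₁₁ t * p t + a₁₂ t * q t + b₁ t) t ∧ HasDerivAt q (a₂₁ t * p t + a₂₂ t * q t + b₂ t) t) ∧ ∀ s : Set ℝ, IsOpen s → ContDiffOn ℝ ∞ a₁₁ s → ContDiffOn ℝ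 ∞ a₁₂ s → ContDiffOn ℝ ∞ a₂₁ s → ContDiffOn ℝ ∞ a₂₂ s → ContDiffOn ℝ ∞ b₁ s → ContDiffOn ℝ ∞ b₂ s → ContDiffOn ℝ ∞ p s ∧ ContDiffOn ℝ ∞ q s := by
  intro a₁₁ a₁₂ a₂₁ a₂₂ b₁ b₂ h₁₁ h₁₂ h₂₁ h₂₂ hb₁ hb₂ t₀ p₀ q₀
  obtain ⟨L, hLc, hLz, hLs⟩ := exists_clmField_two a₁₁ a₁₂ a₂₁ a₂₂ h₁₁ h₁₂ h₂₁ h₂₂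
  obtain ⟨v, hv0, hv⟩ := exists_solution_affine (b := fun t => (b₁ t, b₂ t)) hLc (hb₁.prodMk hb₂) t₀ (p₀, q₀)
  have hv' : ∀ t, HasDerivAt v ((a₁₁ t * (v t).1 + a₁₂ t * (v t).2 + b₁ t, a₂₁ t * (v t).1 + a₂₂ t * (v t).2 + b₂ t)) t := by
    intro t
    have h := hv t
    rwa [hLz, Prod.mk_add_mk] at h
  refine ⟨fun t => (v t).1, fun t => (v t).2, by simp [hv0], by simp [hv0], fun t => ⟨?_, ?_⟩, ?_⟩
  · simpa [Function.comp_def] using (ContinuousLinearMap.fst ℝ ℂ ℂ).hasFDerivAt.comp_hasDerivAt t (hv' t)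
  · simpa [Function.comp_def] using (ContinuousLinearMap.snd ℝ ℂ ℂ).hasFDerivAt.comp_hasDerivAt t (hv' t)
  · intro s hs g₁₁ g₁₂ g₂₁ g₂₂ gb₁ gb₂
    have hvs : ContDiffOn ℝ ∞ v s :=
      contDiffOn_of_hasDerivAt_affine hs (hLs s g₁₁ g₁₂ g₂₁ g₂₂) (gb₁.prodMk gb₂) fun t _ => hv t
    exact ⟨contDiff_fst.comp_contDiffOn hvs, contDiff_snd.comp_contDiffOn hvs⟩

/-- **UNIQUENESS FOR THE COMPLEX `2 × 2` AFFINE SYSTEM** on an open interval `(a, c)` with continuous coefficients there: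
two solutions with the same values at one `t₀ ∈ (a, c)` agree on `(a, c)`. [folklore] -/
theorem eqOn_of_affine_solution_two : ∀ (a₁₁ a₁₂ a₂₁ a₂₂ b₁ b₂ : ℝ → ℂ) (a c t₀ : ℝ), t₀ ∈ Set.Ioo a c → ContinuousOn a₁₁ (Set.Ioo a c) → ContinuousOn a₁₂ (Set.Ioo a c) → ContinuousOn a₂₁ (Set.Ioo a c) → ContinuousOn a₂₂ (Set.Ioo a c) → ∀ (p q p' q' : ℝ → ℂ), (∀ t ∈ Set.Ioo a c, HasDerivAt p (a₁₁ t * p t + a₁₂ t * q t + b₁ t) t ∧ HasDerivAt q (a₂₁ t * p t + a₂₂ t * q t + b₂ t) t) → (∀ t ∈ Set.Ioo a c, HasDerivAt p' (a₁₁ t * p' t + a₁₂ t * q' t + b₁ t) t ∧ HasDerivAt q' (a₂₁ t * p' t + a₂₂ t * q' t + b₂ t) t) → p t₀ = p' t₀ → q t₀ = q' t₀ → Set.EqOn p p' (Set.Ioo a c) ∧ Set.EqOn q q' (Set.Ioo a c) := by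
  intro a₁₁ a₁₂ a₂₁ a₂₂ b₁ b₂ a c t₀ ht₀ h₁₁ h₁₂ h₂₁ h₂₂ p q p' q' h h' hp hq
  -- on each compact `[a', c'] ⊆ (a, c)` containing `t₀` and the point in question, clamp the coefficients to `[a', c']`
  -- (`Set.projIcc`) to get a globally continuous field, and apply the affine uniqueness on `(a', c')`.
  have main : ∀ a' c', a < a' → c' < c → t₀ ∈ Ioo a' c' → EqOn p p' (Ioo a' c') ∧ EqOn q q' (Ioo a' c') := by
    intro a' c' ha' hc' ht₀'
    have hac : a' ≤ c' := (ht₀'.1.trans ht₀'.2).le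
    have hsub : Icc a' c' ⊆ Ioo a c := fun t ht => ⟨ha'.trans_le ht.1, ht.2.trans_lt hc'⟩
    -- clamped (globally continuous) coefficients
    have hcl : Continuous (fun t : ℝ => (projIcc a' c' hac t : ℝ)) := continuous_subtype_val.comp continuous_projIcc
    have hmem : ∀ t, (projIcc a' c' hac t : ℝ) ∈ Ioo a c := fun t => hsub (projIcc a' c' hac t).2
    have hext : ∀ {g : ℝ → ℂ}, ContinuousOn g (Ioo a c) → Continuous fun t => g (projIcc a' c' hac t) :=
      fun hg => hg.comp_continuous hcl hmem
    obtain ⟨L, hLc, hLz, -⟩ := exists_clmField_two _ _ _ _ (hext h₁₁) (hext h₁₂) (hext h₂₁) (hext h₂₂)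
    have hid : ∀ t ∈ Ioo a' c', (projIcc a' c' hac t : ℝ) = t := fun t ht => by
      rw [projIcc_of_mem hac (Ioo_subset_Icc_self ht)]
    have hsol : ∀ {u w : ℝ → ℂ}, (∀ t ∈ Ioo a c, HasDerivAt u (a₁₁ t * u t + a₁₂ t * w t + b₁ t) t ∧
        HasDerivAt w (a₂₁ t * u t + a₂₂ t * w t + b₂ t) t) →
        ∀ t ∈ Ioo a' c', HasDerivAt (fun s => (u s, w s)) (L t (u t, w t) + (b₁ t, b₂ t)) t := by
      intro u w hu t ht
      obtain ⟨hu1, hu2⟩ := hu t (hsub (Ioo_subset_Icc_self ht))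
      rw [hLz, hid t ht, Prod.mk_add_mk]
      exact hu1.prodMk hu2
    have key := eqOn_of_hasDerivAt_affine (L := L) (b := fun t => (b₁ t, b₂ t)) ht₀' hLc.continuousOn (hsol h) (hsol h')
      (Prod.ext hp hq)
    exact ⟨fun t ht => congrArg Prod.fst (key ht), fun t ht => congrArg Prod.snd (key ht)⟩
  refine ⟨fun t ht => ?_, fun t ht => ?_⟩
  · obtain ⟨h1, h2⟩ := main ((a + min t t₀) / 2) ((c + max t t₀) / 2)
      (by have := lt_min ht.1 ht₀.1; linarith) (by have := max_lt ht.2 ht₀.2; linarith)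
      ⟨by have := min_le_right t t₀; have := lt_min ht.1 ht₀.1; linarith,
        by have := le_max_right t t₀; have := max_lt ht.2 ht₀.2; linarith⟩
    exact h1 ⟨by have := min_le_left t t₀; have := lt_min ht.1 ht₀.1; linarith,
      by have := le_max_left t t₀; have := max_lt ht.2 ht₀.2; linarith⟩
  · obtain ⟨h1, h2⟩ := main ((a + min t t₀) / 2) ((c + max t t₀) / 2)
      (by have := lt_min ht.1 ht₀.1; linarith) (by have := max_lt ht.2 ht₀.2; linarith)
      ⟨by have := min_le_right t t₀; have := lt_min ht.1 ht₀.1; linarith,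
        by have := le_max_right t t₀; have := max_lt ht.2 ht₀.2; linarith⟩
    exact h2 ⟨by have := min_le_left t t₀; have := lt_min ht.1 ht₀.1; linarith,
      by have := le_max_left t t₀; have := max_lt ht.2 ht₀.2; linarith⟩

/-! ## `IsRegularPair` depends only on the germ at the centre -/

/-- GLUING A RADIAL VECTOR FIELD: if `F` is a smooth field on `ℝ³` with `F y = φ₀(log ‖y‖)·y` off the origin and the smooth
`φ` agrees with `φ₀` on `(−∞, b)`, then `y ↦ φ(log ‖y‖)·y` (value `F 0` at the origin) is again a smooth field: it is `F` on
the ball `‖y‖ < e^b` and smooth off the origin. [folklore] -/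
theorem exists_field_of_eqOn {φ φ₀ : ℝ → ℝ} {F : V3 → V3} {b : ℝ} (hF : ContDiff ℝ ∞ F) (hφ : ContDiff ℝ ∞ φ)
    (heq : EqOn φ φ₀ (Iio b)) (hFφ : ∀ y : V3, y ≠ 0 → φ₀ (Real.log ‖y‖) • y = F y) :
    ∃ F' : V3 → V3, ContDiff ℝ ∞ F' ∧ ∀ y : V3, y ≠ 0 → φ (Real.log ‖y‖) • y = F' y := by
  classical
  refine ⟨fun y => if y = 0 then F 0 else φ (Real.log ‖y‖) • y, ?_, fun y hy => by simp [hy]⟩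
  refine contDiff_iff_contDiffAt.2 fun y => ?_
  by_cases hyb : ‖y‖ < Real.exp b
  · -- near `y` the new field is the old one
    refine hF.contDiffAt.congr_of_eventuallyEq ?_
    have hyB : y ∈ Metric.ball (0 : V3) (Real.exp b) := by simpa using hyb
    filter_upwards [Metric.isOpen_ball.mem_nhds hyB] with z hz
    by_cases hz0 : z = 0
    · simp [hz0]
    · have hzpos : 0 < ‖z‖ := norm_pos_iff.2 hz0
      have hzb : Real.log ‖z‖ < b := by
        rw [Real.log_lt_iff_lt_exp hzpos]
        simpa using hz
      rw [if_neg hz0, heq hzb, hFφ z hz0]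
  · -- off the origin the explicit formula is smooth
    have hy : y ≠ 0 := by
      rintro rfl
      exact hyb (by simpa using Real.exp_pos b)
    have hsm : ContDiffAt ℝ ∞ (fun z : V3 => φ (Real.log ‖z‖) • z) y :=
      (hφ.contDiffAt.comp y ((contDiffAt_norm ℝ hy).log (norm_ne_zero_iff.2 hy))).smul contDiffAt_id
    refine hsm.congr_of_eventuallyEq ?_
    filter_upwards [isOpen_ne.mem_nhds hy] with z hz
    rw [if_neg hz]

/-- GLUING A RADIAL SCALAR FIELD: if `G` is smooth on `ℝ³` with `G y = ‖y‖·φ₀(log ‖y‖)` off the origin and the smooth `φ`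
agrees with `φ₀` on `(−∞, b)`, then `y ↦ ‖y‖·φ(log ‖y‖)` (value `G 0` at the origin) is again smooth. [folklore] -/
theorem exists_scalar_of_eqOn {φ φ₀ : ℝ → ℝ} {G : V3 → ℝ} {b : ℝ} (hG : ContDiff ℝ ∞ G) (hφ : ContDiff ℝ ∞ φ)
    (heq : EqOn φ φ₀ (Iio b)) (hGφ : ∀ y : V3, y ≠ 0 → ‖y‖ * φ₀ (Real.log ‖y‖) = G y) :
    ∃ G' : V3 → ℝ, ContDiff ℝ ∞ G' ∧ ∀ y : V3, y ≠ 0 → ‖y‖ * φ (Real.log ‖y‖) = G' y := by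
  classical
  refine ⟨fun y => if y = 0 then G 0 else ‖y‖ * φ (Real.log ‖y‖), ?_, fun y hy => by simp [hy]⟩
  refine contDiff_iff_contDiffAt.2 fun y => ?_
  by_cases hyb : ‖y‖ < Real.exp b
  · refine hG.contDiffAt.congr_of_eventuallyEq ?_
    have hyB : y ∈ Metric.ball (0 : V3) (Real.exp b) := by simpa using hyb
    filter_upwards [Metric.isOpen_ball.mem_nhds hyB] with z hz
    by_cases hz0 : z = 0
    · simp [hz0]
    · have hzpos : 0 < ‖z‖ := norm_pos_iff.2 hz0
      have hzb : Real.log ‖z‖ < b := by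
        rw [Real.log_lt_iff_lt_exp hzpos]
        simpa using hz
      rw [if_neg hz0, heq hzb, hGφ z hz0]
  · have hy : y ≠ 0 := by
      rintro rfl
      exact hyb (by simpa using Real.exp_pos b)
    have hsm : ContDiffAt ℝ ∞ (fun z : V3 => ‖z‖ * φ (Real.log ‖z‖)) y :=
      (contDiffAt_norm ℝ hy).mul (hφ.contDiffAt.comp y ((contDiffAt_norm ℝ hy).log (norm_ne_zero_iff.2 hy)))
    refine hsm.congr_of_eventuallyEq ?_
    filter_upwards [isOpen_ne.mem_nhds hy] with z hz
    rw [if_neg hz]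

/-- **Registered helper `isRegularPair_of_eqOn`: `IsRegularPair` IS A GERM CONDITION AT THE CENTRE.** If `(ŵ₀, ŝ₀)` is a
regular pair (`…R2Modes.IsRegularPair`: `C^∞` with the four radial fields `Re/Im ŵ(log‖y‖)·y`, `‖y‖·Re/Im ŝ(log‖y‖)`
extending to smooth fields on `ℝ³`) and the `C^∞` pair `(ŵ, ŝ)` agrees with it on some `(−∞, b)`, then `(ŵ, ŝ)` is a
regular pair: the new fields coincide with the old smooth ones on the ball `‖y‖ < e^b` and are smooth off the origin.
[folklore] -/
theorem isRegularPair_of_eqOn : ∀ (ŵ₀ ŝ₀ ŵ ŝ : ℝ → ℂ) (b : ℝ), IsRegularPair ŵ₀ ŝ₀ → ContDiff ℝ ∞ ŵ → ContDiff ℝ ∞ ŝ → Set.EqOn ŵ ŵ₀ (Set.Iio b) → Set.EqOn ŝ ŝ₀ (Set.Iio b) → IsRegularPair ŵ ŝ := by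
  intro ŵ₀ ŝ₀ ŵ ŝ b h₀ hŵ hŝ hw hs
  obtain ⟨-, -, F₁, F₂, G₁, G₂, hF₁, hF₂, hG₁, hG₂, hFG⟩ := h₀
  have hre : ∀ {u u₀ : ℝ → ℂ}, EqOn u u₀ (Iio b) → EqOn (fun x => (u x).re) (fun x => (u₀ x).re) (Iio b) :=
    fun h x hx => by simp only [h hx]
  have him : ∀ {u u₀ : ℝ → ℂ}, EqOn u u₀ (Iio b) → EqOn (fun x => (u x).im) (fun x => (u₀ x).im) (Iio b) :=
    fun h x hx => by simp only [h hx]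
  have hŵre : ContDiff ℝ ∞ (fun x => (ŵ x).re) := Complex.reCLM.contDiff.comp hŵ
  have hŵim : ContDiff ℝ ∞ (fun x => (ŵ x).im) := Complex.imCLM.contDiff.comp hŵ
  have hŝre : ContDiff ℝ ∞ (fun x => (ŝ x).re) := Complex.reCLM.contDiff.comp hŝ
  have hŝim : ContDiff ℝ ∞ (fun x => (ŝ x).im) := Complex.imCLM.contDiff.comp hŝ
  obtain ⟨F₁', hF₁', h1⟩ := exists_field_of_eqOn (φ := fun x => (ŵ x).re) (φ₀ := fun x => (ŵ₀ x).re) hF₁ hŵre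
    (hre hw) fun y hy => (hFG y hy).1
  obtain ⟨F₂', hF₂', h2⟩ := exists_field_of_eqOn (φ := fun x => (ŵ x).im) (φ₀ := fun x => (ŵ₀ x).im) hF₂ hŵim
    (him hw) fun y hy => (hFG y hy).2.1
  obtain ⟨G₁', hG₁', h3⟩ := exists_scalar_of_eqOn (φ := fun x => (ŝ x).re) (φ₀ := fun x => (ŝ₀ x).re) hG₁ hŝre
    (hre hs) fun y hy => (hFG y hy).2.2.1
  obtain ⟨G₂', hG₂', h4⟩ := exists_scalar_of_eqOn (φ := fun x => (ŝ x).im) (φ₀ := fun x => (ŝ₀ x).im) hG₂ hŝim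
    (him hs) fun y hy => (hFG y hy).2.2.2
  exact ⟨hŵ, hŝ, F₁', F₂', G₁', G₂', hF₁', hF₂', hG₁', hG₂', fun y hy => ⟨h1 y hy, h2 y hy, h3 y hy, h4 y hy⟩⟩

end Summit.AtomisticToContinuum.HydrodynamicLimit.Theorems.SonicCavityRenewal

end
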